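import Summits.CriticalPhenomena.PercolationContinuityZ3.Theorems.Transplant.FKConnectivityAllQAntipodalCellLevel3
import Summits.CriticalPhenomena.PercolationContinuityZ3.Theorems.Transplant.FKConnectivityAllQAntipodalAndValue
import HarnessLib

/-!
# Connectivity correlation inequalities for `φ_{w,q}`, every `q > 0` — file 45c: **THE VALUE LEVEL** — under `φ_{w,q}` (`0 < q ≤ 1`) on a
# 2-connected series–parallel graph, every increasing event determined by at most three edges is negatively correlated with every
# increasing event not reading those edges

Support file (`--supports stmt-CriticalPhenomena-4575`), FK sub-lane `prim-bschramm-fk-2` (gen 20); builds on p205010 (kernel theorem,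
internal audit signed; external expert review pending).  No definitions, no named facts, no sorries; standard axioms.

* `FK.apPsiC_read3_sub_nonpos_of_isTTSP` — for ANY cell `(C, M)` of the host and any three distinct pairs `x, y, z` (live, contracted, deleted or
  even outside the host): `f` increasing reading only `x, y, z`, `g` increasing on the subsets of `M` reading none of `x, y, z` nor `C` ⟹
  `apPsiC q M C f g ≤ 0` (absorb the non-live ones into `f`, then files 45b / 45a by the number of live ones);
* **`FK.rcMeasureW_read3_inter_le_of_isTTSP`** — `E` TTSP between `s, t`, `st ∉ E`, `w` vanishing off `H = E ∪ {st}`, `0 < q ≤ 1`,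
  `A` an increasing event with `insert e ω ∈ A ↔ ω ∈ A` for every `e ∉ {x, y, z}`, `B` an increasing event with `insert e ω ∈ B ↔ ω ∈ B` for
  `e ∈ {x, y, z}` ⟹ `φ_{w,q}(A ∩ B) ≤ φ_{w,q}(A)·φ_{w,q}(B)` (gen 19's bridge `FK.rcMeasureW_real_inter_le_of_apPsiC_nonpos_on`).
  Instances: `A = {maj(ω_x, ω_y, ω_z)}`, `{≥ 2 of 3}`, `{ω_x ∧ (ω_y ∨ ω_z)}`, … against any increasing `B` off `x, y, z` — negative correlation
  under the random-cluster measure with `q ≤ 1` on series–parallel graphs beyond the single-edge / AND / OR cases of gens 8 and 19.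
[cite: Grimmett2006, §1.4 eq. (1.20) (p. 15); §3.8 Thm. (3.90) (pp. 61–62); §3.9 (pp. 63–64)] [cite: Wagner2006, Thm. 5.8(d), §5.3]
-/

noncomputable section

namespace Summit.CriticalPhenomena.PercolationContinuityZ3.Theorems

namespace FK

open MeasureTheory Literature.Probability.LatticeModels Literature.Probability.Percolation
open Literature.Probability.Percolation.DecisionTree (ind ind_of_mem ind_of_not_mem)
open scoped Classical

universe u

variable {V : Type u} [Fintype V] {s t : V}

/-! ### Absorbing a non-live pair into `f` -/

omit [Fintype V] in
/-- Absorbing a pair `e ∉ M` into the test function does not change the cell functional: `e` is either always present (`e ∈ C`) or always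
absent in the arguments `γ ∪ C`. [folklore] -/
theorem apPsiC_absorb (q : ℝ) {M C : Finset (Sym2 V)} {e : Sym2 V} (heM : e ∉ M) (f g : Finset (Sym2 V) → ℝ) :
    apPsiC q M C f g = apPsiC q M C (fun X => f (if e ∈ C then insert e X else X.erase e)) g := by
  refine apPsiC_congr_odd q g fun γ hγ => ?_
  by_cases he : e ∈ C
  · simp only [if_pos he, Finset.insert_eq_of_mem (Finset.mem_union_right _ he)]
  · have h1 : e ∉ γ ∪ C := fun h => by
      rcases Finset.mem_union.1 h with h | h
      · exact heM (hγ h)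
      · exact he h
    have h2 : e ∉ M \ γ ∪ C := fun h => by
      rcases Finset.mem_union.1 h with h | h
      · exact heM (Finset.sdiff_subset h)
      · exact he h
    simp only [if_neg he, Finset.erase_eq_of_notMem h1, Finset.erase_eq_of_notMem h2]

omit [Fintype V] in
/-- The absorbed function reads one pair fewer. [folklore] -/
theorem absorb_notRead {f : Finset (Sym2 V) → ℝ} {R C : Finset (Sym2 V)} {e : Sym2 V}
    (hf : ∀ e' : Sym2 V, e' ∉ R → ∀ A : Finset (Sym2 V), f (insert e' A) = f A) :
    ∀ e' : Sym2 V, e' ∉ R.erase e → ∀ A : Finset (Sym2 V),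
      (fun X => f (if e ∈ C then insert e X else X.erase e)) (insert e' A) = (fun X => f (if e ∈ C then insert e X else X.erase e)) A := by
  intro e' he' A
  by_cases hee : e' = e
  · subst hee
    by_cases he : e' ∈ C
    · simp only [if_pos he, Finset.insert_idem]
    · simp only [if_neg he, Finset.erase_insert_eq_erase]
  · have he'R : e' ∉ R := fun h => he' (Finset.mem_erase.2 ⟨hee, h⟩)
    by_cases he : e ∈ C
    · simp only [if_pos he, Finset.insert_comm e e', hf e' he'R]
    · simp only [if_neg he, Finset.erase_insert_of_ne hee, hf e' he'R]

omit [Fintype V] in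
/-- The absorbed function is increasing when `f` is. [folklore] -/
theorem absorb_mono {f : Finset (Sym2 V) → ℝ} {C : Finset (Sym2 V)} {e : Sym2 V}
    (hfmono : ∀ ⦃A B : Finset (Sym2 V)⦄, A ⊆ B → f A ≤ f B) :
    ∀ ⦃A B : Finset (Sym2 V)⦄, A ⊆ B →
      (fun X => f (if e ∈ C then insert e X else X.erase e)) A ≤ (fun X => f (if e ∈ C then insert e X else X.erase e)) B := by
  intro A B hAB
  by_cases he : e ∈ C
  · simp only [if_pos he]; exact hfmono (Finset.insert_subset_insert _ hAB)
  · simp only [if_neg he]; exact hfmono (Finset.erase_subset_erase _ hAB)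

omit [Fintype V] in
/-- Reading only `R ⊆ R'` implies reading only `R'`. [folklore] -/
theorem notRead_of_subset {f : Finset (Sym2 V) → ℝ} {R R' : Finset (Sym2 V)} (hRR' : R ⊆ R')
    (hf : ∀ e : Sym2 V, e ∉ R → ∀ A : Finset (Sym2 V), f (insert e A) = f A) :
    ∀ e : Sym2 V, e ∉ R' → ∀ A : Finset (Sym2 V), f (insert e A) = f A := fun e he => hf e fun h => he (hRR' h)

omit [Fintype V] in
/-- The `g`-side may be replaced by `X ↦ g (X ∪ C)`: the cell functional only evaluates `g` at arguments containing `C`. [folklore] -/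
theorem apPsiC_right_union (q : ℝ) (M C : Finset (Sym2 V)) (f g : Finset (Sym2 V) → ℝ) :
    apPsiC q M C f g = apPsiC q M C f (fun X => g (X ∪ C)) := by
  unfold apPsiC
  refine Finset.sum_congr rfl fun γ _ => ?_
  simp only [Finset.union_assoc, Finset.union_idempotent]

/-! ### Three read pairs, any cell -/

/-- **Any cell, `f` reading three pairs wherever they sit** (`0 < q ≤ 1`): `M, C ⊆ E ∪ {st}` disjoint, `x, y, z` distinct pairs, `f` increasing
reading only `x, y, z`, `g` increasing on the subsets of `M` reading none of `x, y, z` nor the edges of `C` ⟹ `apPsiC q M C f g ≤ 0`.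
[cite: Grimmett2006, §3.8 Thm. (3.90) (pp. 61–62); §3.9 (pp. 63–64)] -/
theorem apPsiC_read3_sub_nonpos_of_isTTSP {q : ℝ} (hq0 : 0 < q) (hq1 : q ≤ 1) {E : Finset (Sym2 V)} (hE : IsTTSP E s t)
    (hst : s(s, t) ∉ E) {M C : Finset (Sym2 V)} (hM : M ⊆ insert s(s, t) E) (hC : C ⊆ insert s(s, t) E) (hMC : Disjoint M C)
    {x y z : Sym2 V} (hxy : x ≠ y) (hxz : x ≠ z) (hyz : y ≠ z) {f g : Finset (Sym2 V) → ℝ}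
    (hf : ∀ e : Sym2 V, e ∉ ({x, y, z} : Finset (Sym2 V)) → ∀ A : Finset (Sym2 V), f (insert e A) = f A)
    (hfmono : ∀ ⦃A B : Finset (Sym2 V)⦄, A ⊆ B → f A ≤ f B)
    (hgx : ∀ A : Finset (Sym2 V), g (insert x A) = g A) (hgy : ∀ A : Finset (Sym2 V), g (insert y A) = g A)
    (hgz : ∀ A : Finset (Sym2 V), g (insert z A) = g A) (hgC : ∀ e ∈ C, ∀ A : Finset (Sym2 V), g (insert e A) = g A)
    (hmono : ∀ ⦃A B : Finset (Sym2 V)⦄, A ⊆ B → B ⊆ M → g A ≤ g B) :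
    apPsiC q M C f g ≤ 0 := by
  -- the absorbed test functions and their properties (explicit lambdas, to keep unification first-order)
  have R1 : ∀ e₁ : Sym2 V, ∀ e' : Sym2 V, e' ∉ ({x, y, z} : Finset (Sym2 V)).erase e₁ → ∀ A : Finset (Sym2 V),
      (fun X => f (if e₁ ∈ C then insert e₁ X else X.erase e₁)) (insert e' A) =
        (fun X => f (if e₁ ∈ C then insert e₁ X else X.erase e₁)) A :=
    fun e₁ => absorb_notRead (R := ({x, y, z} : Finset (Sym2 V))) (C := C) (e := e₁) hf
  have M1 : ∀ e₁ : Sym2 V, ∀ ⦃A B : Finset (Sym2 V)⦄, A ⊆ B →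
      (fun X => f (if e₁ ∈ C then insert e₁ X else X.erase e₁)) A ≤ (fun X => f (if e₁ ∈ C then insert e₁ X else X.erase e₁)) B :=
    fun e₁ => absorb_mono (C := C) (e := e₁) hfmono
  have R2 : ∀ e₁ e₂ : Sym2 V, ∀ e' : Sym2 V, e' ∉ (({x, y, z} : Finset (Sym2 V)).erase e₁).erase e₂ → ∀ A : Finset (Sym2 V),
      (fun X => (fun X => f (if e₁ ∈ C then insert e₁ X else X.erase e₁)) (if e₂ ∈ C then insert e₂ X else X.erase e₂)) (insert e' A) =
        (fun X => (fun X => f (if e₁ ∈ C then insert e₁ X else X.erase e₁)) (if e₂ ∈ C then insert e₂ X else X.erase e₂)) A :=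
    fun e₁ e₂ => absorb_notRead (f := fun X => f (if e₁ ∈ C then insert e₁ X else X.erase e₁))
      (R := (({x, y, z} : Finset (Sym2 V)).erase e₁)) (C := C) (e := e₂) (R1 e₁)
  have M2 : ∀ e₁ e₂ : Sym2 V, ∀ ⦃A B : Finset (Sym2 V)⦄, A ⊆ B →
      (fun X => (fun X => f (if e₁ ∈ C then insert e₁ X else X.erase e₁)) (if e₂ ∈ C then insert e₂ X else X.erase e₂)) A ≤
        (fun X => (fun X => f (if e₁ ∈ C then insert e₁ X else X.erase e₁)) (if e₂ ∈ C then insert e₂ X else X.erase e₂)) B :=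
    fun e₁ e₂ => absorb_mono (f := fun X => f (if e₁ ∈ C then insert e₁ X else X.erase e₁)) (C := C) (e := e₂) (M1 e₁)
  have R3 : ∀ e₁ e₂ e₃ : Sym2 V, ∀ e' : Sym2 V, e' ∉ ((({x, y, z} : Finset (Sym2 V)).erase e₁).erase e₂).erase e₃ →
      ∀ A : Finset (Sym2 V),
      (fun X => (fun X => (fun X => f (if e₁ ∈ C then insert e₁ X else X.erase e₁)) (if e₂ ∈ C then insert e₂ X else X.erase e₂))
          (if e₃ ∈ C then insert e₃ X else X.erase e₃)) (insert e' A) =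
        (fun X => (fun X => (fun X => f (if e₁ ∈ C then insert e₁ X else X.erase e₁)) (if e₂ ∈ C then insert e₂ X else X.erase e₂))
          (if e₃ ∈ C then insert e₃ X else X.erase e₃)) A :=
    fun e₁ e₂ e₃ => absorb_notRead
      (f := fun X => (fun X => f (if e₁ ∈ C then insert e₁ X else X.erase e₁)) (if e₂ ∈ C then insert e₂ X else X.erase e₂))
      (R := ((({x, y, z} : Finset (Sym2 V)).erase e₁).erase e₂)) (C := C) (e := e₃) (R2 e₁ e₂)
  -- membership bookkeeping
  have mem3 : ∀ e : Sym2 V, e ∈ ({x, y, z} : Finset (Sym2 V)) ↔ e = x ∨ e = y ∨ e = z := fun e => by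
    simp only [Finset.mem_insert, Finset.mem_singleton]
  have sub1 : ∀ a b c : Sym2 V, ({a, b, c} : Finset (Sym2 V)) = {x, y, z} → ({x, y, z} : Finset (Sym2 V)).erase a ⊆ {b, c} := by
    intro a b c habc e he
    have h := Finset.mem_erase.1 he
    rw [← habc] at h
    simp only [Finset.mem_insert, Finset.mem_singleton] at h ⊢
    tauto
  have sub2 : ∀ a b c : Sym2 V, ({a, b, c} : Finset (Sym2 V)) = {x, y, z} → (({x, y, z} : Finset (Sym2 V)).erase a).erase b ⊆ {c} := by
    intro a b c habc e he
    have h := Finset.mem_erase.1 he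
    have h' := Finset.mem_erase.1 h.2
    rw [← habc] at h'
    simp only [Finset.mem_insert, Finset.mem_singleton] at h' ⊢
    tauto
  have sub3 : ((({x, y, z} : Finset (Sym2 V)).erase z).erase y).erase x ⊆ ∅ := by
    intro e he
    have h := Finset.mem_erase.1 he
    have h' := Finset.mem_erase.1 h.2
    have h'' := Finset.mem_erase.1 h'.2
    simp only [Finset.mem_insert, Finset.mem_singleton] at h''
    exfalso; tauto
  have pyxz : ({y, x, z} : Finset (Sym2 V)) = {x, y, z} := by
    ext e; simp only [Finset.mem_insert, Finset.mem_singleton]; tauto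
  have pzxy : ({z, x, y} : Finset (Sym2 V)) = {x, y, z} := by
    ext e; simp only [Finset.mem_insert, Finset.mem_singleton]; tauto
  have pzyx : ({z, y, x} : Finset (Sym2 V)) = {x, y, z} := by
    ext e; simp only [Finset.mem_insert, Finset.mem_singleton]; tauto
  by_cases hzM : z ∈ M
  · by_cases hyM : y ∈ M
    · by_cases hxM : x ∈ M
      · exact apPsiC_level3_sub_nonpos_of_isTTSP hq0 hq1 hE hst hM hC hMC hxM hyM hzM hxy hxz hyz hf (fun A B hAB _ => hfmono hAB)
          hgx hgy hgz hgC hmono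
      · rw [apPsiC_absorb q hxM f g]
        exact apPsiC_level2_sub_nonpos_of_isTTSP hq0 hq1 hE hst hM hC hMC hyM hzM hyz
          (notRead_of_subset (f := fun X => f (if x ∈ C then insert x X else X.erase x)) (sub1 x y z rfl) (R1 x)) (fun A B hAB _ => M1 x hAB) hgy hgz hgC hmono
    · by_cases hxM : x ∈ M
      · rw [apPsiC_absorb q hyM f g]
        exact apPsiC_level2_sub_nonpos_of_isTTSP hq0 hq1 hE hst hM hC hMC hxM hzM hxz
          (notRead_of_subset (f := fun X => f (if y ∈ C then insert y X else X.erase y)) (sub1 y x z pyxz) (R1 y)) (fun A B hAB _ => M1 y hAB) hgx hgz hgC hmono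
      · rw [apPsiC_absorb q hxM f g, apPsiC_absorb q hyM]
        exact apPsiC_level1_sub_nonpos_of_isTTSP hq0 hq1 hE hst hM hC hMC hzM
          (notRead_of_subset (f := fun X => (fun X => f (if x ∈ C then insert x X else X.erase x)) (if y ∈ C then insert y X else X.erase y))
            (sub2 x y z rfl) (R2 x y)) (M2 x y (Finset.empty_subset _)) hgz hgC hmono
  · by_cases hyM : y ∈ M
    · by_cases hxM : x ∈ M
      · rw [apPsiC_absorb q hzM f g]
        exact apPsiC_level2_sub_nonpos_of_isTTSP hq0 hq1 hE hst hM hC hMC hxM hyM hxy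
          (notRead_of_subset (f := fun X => f (if z ∈ C then insert z X else X.erase z)) (sub1 z x y pzxy) (R1 z)) (fun A B hAB _ => M1 z hAB) hgx hgy hgC hmono
      · rw [apPsiC_absorb q hzM f g, apPsiC_absorb q hxM]
        exact apPsiC_level1_sub_nonpos_of_isTTSP hq0 hq1 hE hst hM hC hMC hyM
          (notRead_of_subset (f := fun X => (fun X => f (if z ∈ C then insert z X else X.erase z)) (if x ∈ C then insert x X else X.erase x))
            (sub2 z x y pzxy) (R2 z x)) (M2 z x (Finset.empty_subset _)) hgy hgC hmono
    · by_cases hxM : x ∈ M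
      · rw [apPsiC_absorb q hzM f g, apPsiC_absorb q hyM]
        exact apPsiC_level1_sub_nonpos_of_isTTSP hq0 hq1 hE hst hM hC hMC hxM
          (notRead_of_subset (f := fun X => (fun X => f (if z ∈ C then insert z X else X.erase z)) (if y ∈ C then insert y X else X.erase y))
            (sub2 z y x pzyx) (R2 z y)) (M2 z y (Finset.empty_subset _)) hgx hgC hmono
      · rw [apPsiC_absorb q hzM f g, apPsiC_absorb q hyM, apPsiC_absorb q hxM]
        exact le_of_eq (apPsiC_eq_zero_of_notRead (fun e A => notRead_of_subset (f := fun X => (fun X => (fun X => f (if z ∈ C then insert z X else X.erase z)) (if y ∈ C then insert y X else X.erase y)) (if x ∈ C then insert x X else X.erase x))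
          sub3 (R3 z y x) e (Finset.notMem_empty _) A) g)

/-! ### The value level -/

/-- **NEGATIVE CORRELATION AT THE VALUE LEVEL, three read edges** (`0 < q ≤ 1`).  `E` two-terminal series–parallel between `s, t`, `st ∉ E`,
`w : Sym2 V → [0,1]` vanishing off `H = E ∪ {st}` (a weighted 2-connected series–parallel graph), `x, y, z` distinct pairs; `A` an increasing event
reading only `x, y, z` (`insert e ω ∈ A ↔ ω ∈ A` for `e ∉ {x,y,z}`), `B` an increasing event reading none of `x, y, z` ⟹
`φ_{w,q}(A ∩ B) ≤ φ_{w,q}(A)·φ_{w,q}(B)` — every coefficient of `Z_H² Cov_{φ_{z,q}}(1_A, 1_B)` is `≤ 0` (`FK.apPsiC_read3_sub_nonpos_of_isTTSP`) and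
gen 19's bridge `FK.rcMeasureW_real_inter_le_of_apPsiC_nonpos_on` sums them.
[cite: Grimmett2006, §1.4 eq. (1.20) (p. 15); §3.8 Thm. (3.90) (pp. 61–62); §3.9 (pp. 63–64)] [cite: Wagner2006, Thm. 5.8(d), §5.3] -/
theorem rcMeasureW_read3_inter_le_of_isTTSP {q : ℝ} (hq0 : 0 < q) (hq1 : q ≤ 1) {E : Finset (Sym2 V)} (hE : IsTTSP E s t)
    (hst : s(s, t) ∉ E) (w : Sym2 V → unitInterval) (hw : ∀ e, e ∉ insert s(s, t) E → ((w e : ℝ)) = 0)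
    {x y z : Sym2 V} (hxy : x ≠ y) (hxz : x ≠ z) (hyz : y ≠ z) (A B : Set (BondConfig V))
    (hA : ∀ (ω : BondConfig V) (e : Sym2 V), e ∉ ({x, y, z} : Finset (Sym2 V)) → (insert e ω ∈ A ↔ ω ∈ A))
    (hAmono : ∀ ω ω' : BondConfig V, ω ⊆ ω' → ω ∈ A → ω' ∈ A)
    (hBx : ∀ ω : BondConfig V, insert x ω ∈ B ↔ ω ∈ B) (hBy : ∀ ω : BondConfig V, insert y ω ∈ B ↔ ω ∈ B)
    (hBz : ∀ ω : BondConfig V, insert z ω ∈ B ↔ ω ∈ B) (hBmono : ∀ ω ω' : BondConfig V, ω ⊆ ω' → ω ∈ B → ω' ∈ B) :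
    (rcMeasureW w q ∅).real (A ∩ B) ≤ (rcMeasureW w q ∅).real A * (rcMeasureW w q ∅).real B := by
  refine rcMeasureW_real_inter_le_of_apPsiC_nonpos_on hq0 w (insert s(s, t) E) hw A B fun σ S hSσ hσ hS => ?_
  have hSσd : Disjoint S σ := Finset.disjoint_of_subset_left hSσ Finset.sdiff_disjoint
  -- indicator test functions on finite configurations
  have indI : ∀ (X : Set (BondConfig V)) (e : Sym2 V) (P : Finset (Sym2 V)),
      (insert e (↑P : BondConfig V) ∈ X ↔ (↑P : BondConfig V) ∈ X) → ind X (↑(insert e P) : BondConfig V) = ind X ↑P := by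
    intro X e P h
    rw [Finset.coe_insert]
    by_cases hP : (↑P : BondConfig V) ∈ X
    · rw [ind_of_mem hP, ind_of_mem (h.2 hP)]
    · rw [ind_of_not_mem hP, ind_of_not_mem (fun h' => hP (h.1 h'))]
  have indM : ∀ (X : Set (BondConfig V)), (∀ ω ω' : BondConfig V, ω ⊆ ω' → ω ∈ X → ω' ∈ X) →
      ∀ ⦃P Q : Finset (Sym2 V)⦄, P ⊆ Q → ind X (↑P : BondConfig V) ≤ ind X ↑Q := by
    intro X hX P Q hPQ
    by_cases hP : (↑P : BondConfig V) ∈ X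
    · rw [ind_of_mem hP, ind_of_mem (hX _ _ (Finset.coe_subset.2 hPQ) hP)]
    · rw [ind_of_not_mem hP]
      by_cases hQ : (↑Q : BondConfig V) ∈ X
      · rw [ind_of_mem hQ]; exact zero_le_one
      · rw [ind_of_not_mem hQ]
  rw [apPsiC_right_union]
  refine apPsiC_read3_sub_nonpos_of_isTTSP hq0 hq1 hE hst hS hσ hSσd hxy hxz hyz
    (fun e he P => indI A e P (hA _ e he)) (indM A hAmono) (fun P => ?_) (fun P => ?_) (fun P => ?_) (fun e he P => ?_)
    (fun P Q hPQ _ => indM B hBmono (Finset.union_subset_union hPQ le_rfl))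
  · show ind B ↑(insert x P ∪ σ) = ind B ↑(P ∪ σ)
    rw [Finset.insert_union]; exact indI B x _ (hBx _)
  · show ind B ↑(insert y P ∪ σ) = ind B ↑(P ∪ σ)
    rw [Finset.insert_union]; exact indI B y _ (hBy _)
  · show ind B ↑(insert z P ∪ σ) = ind B ↑(P ∪ σ)
    rw [Finset.insert_union]; exact indI B z _ (hBz _)
  · show ind B ↑(insert e P ∪ σ) = ind B ↑(P ∪ σ)
    rw [Finset.insert_union, Finset.insert_eq_of_mem (Finset.mem_union_right _ he)]

/-- **The majority of three edges, value level** (`0 < q ≤ 1`): under `φ_{w,q}` on a weighted 2-connected series–parallel graph, the event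
`maj(ω_x, ω_y, ω_z)` is negatively correlated with every increasing event `B` reading none of `x, y, z` (`FK.rcMeasureW_read3_inter_le_of_isTTSP`).
[cite: Grimmett2006, §3.8 Thm. (3.90) (pp. 61–62); §3.9 (pp. 63–64)] [cite: Wagner2006, Thm. 5.8(d), §5.3] -/
theorem rcMeasureW_maj3_inter_le_of_isTTSP {q : ℝ} (hq0 : 0 < q) (hq1 : q ≤ 1) {E : Finset (Sym2 V)} (hE : IsTTSP E s t)
    (hst : s(s, t) ∉ E) (w : Sym2 V → unitInterval) (hw : ∀ e, e ∉ insert s(s, t) E → ((w e : ℝ)) = 0)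
    {x y z : Sym2 V} (hxy : x ≠ y) (hxz : x ≠ z) (hyz : y ≠ z) (B : Set (BondConfig V))
    (hBx : ∀ ω : BondConfig V, insert x ω ∈ B ↔ ω ∈ B) (hBy : ∀ ω : BondConfig V, insert y ω ∈ B ↔ ω ∈ B)
    (hBz : ∀ ω : BondConfig V, insert z ω ∈ B ↔ ω ∈ B) (hBmono : ∀ ω ω' : BondConfig V, ω ⊆ ω' → ω ∈ B → ω' ∈ B) :
    (rcMeasureW w q ∅).real ({ω : BondConfig V | (x ∈ ω ∧ y ∈ ω) ∨ (x ∈ ω ∧ z ∈ ω) ∨ (y ∈ ω ∧ z ∈ ω)} ∩ B) ≤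
      (rcMeasureW w q ∅).real {ω : BondConfig V | (x ∈ ω ∧ y ∈ ω) ∨ (x ∈ ω ∧ z ∈ ω) ∨ (y ∈ ω ∧ z ∈ ω)} *
        (rcMeasureW w q ∅).real B := by
  refine rcMeasureW_read3_inter_le_of_isTTSP hq0 hq1 hE hst w hw hxy hxz hyz _ B (fun ω e he => ?_) (fun ω ω' hωω' hω => ?_)
    hBx hBy hBz hBmono
  · have hex : x ≠ e := fun h => he (h ▸ by simp)
    have hey : y ≠ e := fun h => he (h ▸ by simp)
    have hez : z ≠ e := fun h => he (h ▸ by simp)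
    simp only [Set.mem_setOf_eq, Set.mem_insert_iff, hex, hey, hez, false_or]
  · simp only [Set.mem_setOf_eq] at hω ⊢
    rcases hω with ⟨h1, h2⟩ | ⟨h1, h2⟩ | ⟨h1, h2⟩
    · exact Or.inl ⟨hωω' h1, hωω' h2⟩
    · exact Or.inr (Or.inl ⟨hωω' h1, hωω' h2⟩)
    · exact Or.inr (Or.inr ⟨hωω' h1, hωω' h2⟩)

end FK

end Summit.CriticalPhenomena.PercolationContinuityZ3.Theorems

end
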